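import Summits.BirchSwinnertonDyer.BirchSwinnertonDyer.Theorems.KolyvaginDepthDoorDepthTableJLSRowsTwoSha
import Summits.BirchSwinnertonDyer.BirchSwinnertonDyer.Theorems.KolyvaginDepthDoorDepthTableJLSRowsTwoSha2
import Summits.BirchSwinnertonDyer.BirchSwinnertonDyer.Theorems.KolyvaginDepthDoorDepthTableRow389a1RankDischarged
import Summits.BirchSwinnertonDyer.BirchSwinnertonDyer.Theorems.KolyvaginDepthDoorDepthTableRowsExactReadingZhang2
import Summits.BirchSwinnertonDyer.BirchSwinnertonDyer.Theorems.Rank2Observatory709a1TwoDescRankTwo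
import Summits.BirchSwinnertonDyer.BirchSwinnertonDyer.Theorems.Rank2Observatory718b1TwoDescRankTwo
import Summits.BirchSwinnertonDyer.BirchSwinnertonDyer.Theorems.KolyvaginDepthDoorDepthTableRowKitSecondSign
import Summits.BirchSwinnertonDyer.BirchSwinnertonDyer.Theorems.KolyvaginDepthDoorKolyvaginDepthSupplyDoorNoTwist
import Summits.BirchSwinnertonDyer.BirchSwinnertonDyer.Theorems.Rank2ObservatoryKernelAnnihilator
import Literature.NumberTheory.EllipticCurves.IrreducibleModPQuadraticTwistProofs
import Literature.NumberTheory.EllipticCurves.NonEisensteinPrimeOfSurjective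
import Literature.NumberTheory.EllipticCurves.LeadingTermProofs
import HarnessLib

/-!
# Route `KolyvaginDepthDoor`, crux `KolyvaginDepthSupplyKN` (stmt-BirchSwinnertonDyer-22820) —
# DEPTH TABLE v12: «ONE BIT ⟺ TWO `Ш`'s» (3/5: `389a1`, `709a1`, `718b1`) — the rank-2 row in pure BSD-invariant
# form, the one point on the Heegner twist SUPPLIED IN THE KERNEL

Helper file of the lead prover of line `levelone` (kdd-p1 g15; `--supports stmt-BirchSwinnertonDyer-22820
--as helper`); it closes nothing and BSD is not proved by it.

v11 (this seat, files `…DepthTableRowsRankDischarged`, `…DepthTableRow<label>RankDischarged`) reads the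
rank-2 rows as «bit ⟺ `Ш(E/ℚ)[p] = 0` ∧ `#Sel_p(E^{(d_K)}/ℚ) ≤ p`» (rank of `E` discharged by the
tree's kernel 2-descent certificates). The remaining Selmer bound on the twist is itself two BSD
invariants once ONE rational point of infinite order on `E^{(d_K)}` is known: with `1 ≤ rank E^{(d_K)}`
and `E^{(d_K)}[p](ℚ) = 0` (twist of an irreducible `ρ̄_{E,p}`), `#Sel_p(E^{(d_K)}) ≤ p` ⟺
«`rank E^{(d_K)} = 1` ∧ `Ш(E^{(d_K)}/ℚ)[p] = 0`» (AEC X.4.2; `natCard_selmerGroup_le_iff_rank_eq_one_sha₁₅₃`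
in part 1). This file SUPPLIES THAT POINT IN THE KERNEL for each row — a rational point on the integer
twist model `[0, d_K b₂, 0, 8 d_K² b₄, 16 d_K³ b₆]` (`u = 1/2`-isomorphic to `E^{(d_K)}`,
`mordellWeilRank_quadraticTwist_eq_twistModel`), found by naive search, NON-ZERO, on a twist that is
TORSION-FREE by the annihilator `t = 1` of two kernel point counts (`nsmul_eq_zero_of_annihilatorCheck`),
hence of infinite order; Mordell–Weil (`module_finite_point_holds`) gives `1 ≤ rank` — and states:

  «∃ frame, Kolyvagin prime `ℓ`, datum: `c_1(ℓ) ≠ 0`»  `↔`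
  «`Ш(E/ℚ)[p] = 0` ∧ `rank_ℤ E^{(d_K)}(ℚ) = 1` ∧ `Ш(E^{(d_K)}/ℚ)[p] = 0`»,

for ANY imaginary quadratic `K` with the row's `d_K`: ONE BIT of Jetchev–Lauter–Stein's algorithm IS the
vanishing of `Ш[p]` of the rank-2 curve AND of its rank-1 Heegner twist (plus the twist's rank), with
nothing else in the statement — no rank of `E`, no `hF`, no twist pinning, no `Ш`-hypothesis, no point
hypothesis. CONDITIONAL on the named print facts of the v10/v11 rows ((γ) + W. Zhang L8.4 (1), resp.
Castella–Sano et al. on the split rows); per curve; BSD is NOT proved by any of this.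

References: [WZhang2014] Lemma 8.4 (1) (p. 236), Thm. 9.1 (p. 240); [CastellaSano2026] Thm. 3;
[GrossLMS1991] Prop. 3.7 (2); [SilvermanAEC2009] VII.3.1 (b), VIII.6.7, X.4.2, X.5 Cor. 5.4;
[JetchevLauterStein2009] §3.6 (arXiv:0707.0032); [CremonaAlgorithms1997] Table 1, §3.6.
-/

set_option linter.dupNamespace false

noncomputable section

open scoped Classical NumberField

namespace Summit.BirchSwinnertonDyer.BirchSwinnertonDyer.Theorems.KolyvaginDepthDoor

open Literature.NumberTheory.EllipticCurves Literature.NumberTheory.EllipticCurves.ModularForms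
  WeierstrassCurve NumberField IsDedekindDomain
open Summit.BirchSwinnertonDyer.BirchSwinnertonDyer.Theorems
open Summit.BirchSwinnertonDyer.BirchSwinnertonDyer.Rank2Observatory

/-! ## The twist side of a bit, given ONE point of infinite order on the twist -/

/-- **`#Sel_p(E') ≤ p` ⟺ «`rank E' = 1` ∧ `Ш(E')[p] = 0`», for `E'/ℚ` with `E'[p]` irreducible and ONE
rational point of infinite order** (`#Sel_p = p^{rank} · #E'(ℚ)[p] · #Ш(E')[p]`, AEC X.4.2; `→` is
`rank_and_sha_of_natCard_selmerGroup_le`, `←` is `natCard_selmerGroup_eq_pow_rank_of_sha_inf_torsionBy_eq_bot`).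
UNCONDITIONAL. [cite: SilvermanAEC2009, Thm. X.4.2] -/
private theorem natCard_selmerGroup_le_iff_rank_eq_one_sha₁₅₃ (W : WeierstrassCurve ℚ) [W.IsElliptic]
    (p : ℕ) [hp : Fact p.Prime] (hirr : W.HasIrreducibleModPGaloisRep p) (h1 : 1 ≤ W.mordellWeilRank) :
    Nat.card (W.selmerGroup p) ≤ p ↔
      (W.mordellWeilRank = 1 ∧
        (W.sha ⊓ AddSubgroup.torsionBy W.galH1 (p : ℤ) : AddSubgroup W.galH1) = ⊥) := by
  constructor
  · intro h
    have h' : Nat.card ↥(selmerGroup W (p : ℤ)) ≤ p ^ 1 := by rw [pow_one]; exact h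
    obtain ⟨hr, -, hbot, -⟩ := rank_and_sha_of_natCard_selmerGroup_le W hp.out.one_lt 1 h' h1
    exact ⟨hr, hbot⟩
  · rintro ⟨hr, hbot⟩
    have h := natCard_selmerGroup_eq_pow_rank_of_sha_inf_torsionBy_eq_bot W p hirr hbot
    rw [hr, pow_one] at h
    exact h.le

/-! ## `389a1` at `(p, d_K) = (5, -7)`: the twist model, its kernel point and torsion-freeness are the landed
`C389a1.AtThree.*` lemmas (file `…DepthTableJLSRowsTwoSha*`) -/

namespace C389a1

/-- **DEPTH-TABLE ROW `389a1`, `(p, d_K) = (5, −7)`, v12 — «ONE BIT ⟺ TWO `Ш`'s».** For `E = 389a1` and ANY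
imaginary quadratic `K` with `d_K = −7`: «some frame, some Kolyvagin prime `ℓ`, some datum of conductor
`ℓ` with `c_1(ℓ) ≠ 0`» `↔` «`Ш(E/ℚ)[5] = 0` ∧ `rank_ℤ E^{(−7)}(ℚ) = 1` ∧ `Ш(E^{(−7)}/ℚ)[5] = 0`». From the
row `C389a1.exactRowZhang_5_neg7` (rank discharged by the kernel 2-descent certificate) and `natCard_selmerGroup_le_iff_rank_eq_one_sha₁₅₃` at the twist, fed with
the kernel point `AtThree.one_le_rank_twist_neg7` (through `mordellWeilRank_quadraticTwist_eq_twistModel`) and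
the irreducibility of `E^{(−7)}[5]` (twist of the onto `ρ̄_{E,5}`). Every side condition is a kernel
theorem; CONDITIONAL on (γ) and W. Zhang's Lemma 8.4 (1) / Thm. 9.1 by name; per curve; BSD is not proved by it.
[cite: WZhang2014, Lemma 8.4 (1) (p. 236), Thm. 9.1 (p. 240)] [cite: GrossLMS1991, Prop. 3.7 (2)]
[cite: SilvermanAEC2009, Thm. X.4.2] [cite: CremonaAlgorithms1997, Table 1 (389a1)] -/
theorem exactRowZhang_5_neg7_twoSha
    (h372 : GrossLMS1991.prop37_2_frobeniusCongruence)
    (h84 : Literature.NumberTheory.EllipticCurves.WZhang2014_lemma84_exists_minimal_kolyvaginClass_one_selmerCard)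
    (K : Type) [Field K] [NumberField K] (hK : IsImaginaryQuadratic K)
    (hD : NumberField.discr K = -7) :
    haveI := curve389a1_isGloballyMinimal;
    haveI : NeZero (Curve389a1.E.conductorNorm ℤ) := neZero_conductorNorm_of_isElliptic _;
    haveI := Fact.mk (by norm_num : Nat.Prime 5);
    (∃ (Dt : ModularParametrizationData (Curve389a1.E) ((Curve389a1.E).conductorNorm ℤ)) (β : ℤ)
      (ι : K →+* ℂ) (ℓ : ℕ) (d : KolyvaginHeegnerData Dt β ι ℓ),
      ℓ.Prime ∧ Zhang2014.IsKolyvaginPrime ((Curve389a1.E).conductorNorm ℤ) (Curve389a1.E) K 5 ℓ ∧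
        d.kolyvaginClass (p := 5) (by norm_num) 1 ≠ 0) ↔
    (((Curve389a1.E).sha ⊓ AddSubgroup.torsionBy (Curve389a1.E).galH1 ((5 : ℕ) : ℤ) : AddSubgroup _) = ⊥ ∧
      ((Curve389a1.E).quadraticTwist (NumberField.discr K : ℚ)).mordellWeilRank = 1 ∧
      (((Curve389a1.E).quadraticTwist (NumberField.discr K : ℚ)).sha ⊓
          AddSubgroup.torsionBy ((Curve389a1.E).quadraticTwist (NumberField.discr K : ℚ)).galH1 ((5 : ℕ) : ℤ) :
          AddSubgroup ((Curve389a1.E).quadraticTwist (NumberField.discr K : ℚ)).galH1) = ⊥) := by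
  haveI := curve389a1_isGloballyMinimal
  haveI : NeZero (Curve389a1.E.conductorNorm ℤ) := neZero_conductorNorm_of_isElliptic _
  haveI := Fact.mk (by norm_num : Nat.Prime 5)
  have hdK : (NumberField.discr K : ℚ) ≠ 0 := by exact_mod_cast NumberField.discr_ne_zero K
  haveI := (Curve389a1.E).isElliptic_quadraticTwist hdK
  have hsur : (Curve389a1.E).HasSurjectiveModNGaloisRep (5 ^ 1 : ℕ) := hasSurjectiveModNGaloisRep_pow_5 1
  rw [pow_one] at hsur
  have hirrT : ((Curve389a1.E).quadraticTwist (NumberField.discr K : ℚ)).HasIrreducibleModPGaloisRep 5 :=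
    ((Curve389a1.E).hasIrreducibleModPGaloisRep_quadraticTwist_iff hdK 5).mpr
      (hasIrreducibleModPGaloisRep_of_hasSurjectiveModNGaloisRep (Curve389a1.E) 5 hsur)
  have h1 : 1 ≤ ((Curve389a1.E).quadraticTwist (NumberField.discr K : ℚ)).mordellWeilRank := by
    rw [hD, mordellWeilRank_quadraticTwist_eq_twistModel intModel (-7), AtThree.twistModel_neg7]
    exact AtThree.one_le_rank_twist_neg7
  exact (exactRowZhang_5_neg7_rankFree h372 h84 K hK hD).trans
    (and_congr_right fun _ ↦ natCard_selmerGroup_le_iff_rank_eq_one_sha₁₅₃ _ 5 hirrT h1)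

end C389a1

/-! ## `709a1` at `(p, d_K) = (5, -7)`: the twist model, its kernel point and torsion-freeness are the landed
`C709a1.AtThree.*` lemmas (file `…DepthTableJLSRowsTwoSha*`) -/

namespace C709a1

/-- **DEPTH-TABLE ROW `709a1`, `(p, d_K) = (5, −7)`, v12 — «ONE BIT ⟺ TWO `Ш`'s».** For `E = 709a1` and ANY
imaginary quadratic `K` with `d_K = −7`: «some frame, some Kolyvagin prime `ℓ`, some datum of conductor
`ℓ` with `c_1(ℓ) ≠ 0`» `↔` «`Ш(E/ℚ)[5] = 0` ∧ `rank_ℤ E^{(−7)}(ℚ) = 1` ∧ `Ш(E^{(−7)}/ℚ)[5] = 0`». From the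
row `C709a1.exactRowZhang_5_neg7` (rank discharged by the kernel 2-descent certificate) and `natCard_selmerGroup_le_iff_rank_eq_one_sha₁₅₃` at the twist, fed with
the kernel point `AtThree.one_le_rank_twist_neg7` (through `mordellWeilRank_quadraticTwist_eq_twistModel`) and
the irreducibility of `E^{(−7)}[5]` (twist of the onto `ρ̄_{E,5}`). Every side condition is a kernel
theorem; CONDITIONAL on (γ) and W. Zhang's Lemma 8.4 (1) / Thm. 9.1 by name; per curve; BSD is not proved by it.
[cite: WZhang2014, Lemma 8.4 (1) (p. 236), Thm. 9.1 (p. 240)] [cite: GrossLMS1991, Prop. 3.7 (2)]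
[cite: SilvermanAEC2009, Thm. X.4.2] [cite: CremonaAlgorithms1997, Table 1 (709a1)] -/
theorem exactRowZhang_5_neg7_twoSha
    (h372 : GrossLMS1991.prop37_2_frobeniusCongruence)
    (h84 : Literature.NumberTheory.EllipticCurves.WZhang2014_lemma84_exists_minimal_kolyvaginClass_one_selmerCard)
    (K : Type) [Field K] [NumberField K] (hK : IsImaginaryQuadratic K)
    (hD : NumberField.discr K = -7) :
    haveI := isElliptic_c709a1;
    haveI := isGloballyMinimal_c709a1;
    haveI : NeZero (((⟨0, -1, 1, -2, 0⟩ : WeierstrassCurve ℤ).map (Int.castRingHom ℚ)).conductorNorm ℤ) := neZero_conductorNorm_of_isElliptic _;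
    haveI := Fact.mk (by norm_num : Nat.Prime 5);
    (∃ (Dt : ModularParametrizationData ((⟨0, -1, 1, -2, 0⟩ : WeierstrassCurve ℤ).map (Int.castRingHom ℚ)) (((⟨0, -1, 1, -2, 0⟩ : WeierstrassCurve ℤ).map (Int.castRingHom ℚ)).conductorNorm ℤ)) (β : ℤ)
      (ι : K →+* ℂ) (ℓ : ℕ) (d : KolyvaginHeegnerData Dt β ι ℓ),
      ℓ.Prime ∧ Zhang2014.IsKolyvaginPrime (((⟨0, -1, 1, -2, 0⟩ : WeierstrassCurve ℤ).map (Int.castRingHom ℚ)).conductorNorm ℤ) ((⟨0, -1, 1, -2, 0⟩ : WeierstrassCurve ℤ).map (Int.castRingHom ℚ)) K 5 ℓ ∧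
        d.kolyvaginClass (p := 5) (by norm_num) 1 ≠ 0) ↔
    ((((⟨0, -1, 1, -2, 0⟩ : WeierstrassCurve ℤ).map (Int.castRingHom ℚ)).sha ⊓ AddSubgroup.torsionBy ((⟨0, -1, 1, -2, 0⟩ : WeierstrassCurve ℤ).map (Int.castRingHom ℚ)).galH1 ((5 : ℕ) : ℤ) : AddSubgroup _) = ⊥ ∧
      (((⟨0, -1, 1, -2, 0⟩ : WeierstrassCurve ℤ).map (Int.castRingHom ℚ)).quadraticTwist (NumberField.discr K : ℚ)).mordellWeilRank = 1 ∧
      ((((⟨0, -1, 1, -2, 0⟩ : WeierstrassCurve ℤ).map (Int.castRingHom ℚ)).quadraticTwist (NumberField.discr K : ℚ)).sha ⊓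
          AddSubgroup.torsionBy (((⟨0, -1, 1, -2, 0⟩ : WeierstrassCurve ℤ).map (Int.castRingHom ℚ)).quadraticTwist (NumberField.discr K : ℚ)).galH1 ((5 : ℕ) : ℤ) :
          AddSubgroup (((⟨0, -1, 1, -2, 0⟩ : WeierstrassCurve ℤ).map (Int.castRingHom ℚ)).quadraticTwist (NumberField.discr K : ℚ)).galH1) = ⊥) := by
  haveI := isElliptic_c709a1
  haveI := isGloballyMinimal_c709a1
  haveI : NeZero (((⟨0, -1, 1, -2, 0⟩ : WeierstrassCurve ℤ).map (Int.castRingHom ℚ)).conductorNorm ℤ) := neZero_conductorNorm_of_isElliptic _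
  haveI := Fact.mk (by norm_num : Nat.Prime 5)
  have hdK : (NumberField.discr K : ℚ) ≠ 0 := by exact_mod_cast NumberField.discr_ne_zero K
  haveI := ((⟨0, -1, 1, -2, 0⟩ : WeierstrassCurve ℤ).map (Int.castRingHom ℚ)).isElliptic_quadraticTwist hdK
  have hsur : ((⟨0, -1, 1, -2, 0⟩ : WeierstrassCurve ℤ).map (Int.castRingHom ℚ)).HasSurjectiveModNGaloisRep (5 ^ 1 : ℕ) := hasSurjectiveModNGaloisRep_pow_5 1
  rw [pow_one] at hsur
  have hirrT : (((⟨0, -1, 1, -2, 0⟩ : WeierstrassCurve ℤ).map (Int.castRingHom ℚ)).quadraticTwist (NumberField.discr K : ℚ)).HasIrreducibleModPGaloisRep 5 :=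
    (((⟨0, -1, 1, -2, 0⟩ : WeierstrassCurve ℤ).map (Int.castRingHom ℚ)).hasIrreducibleModPGaloisRep_quadraticTwist_iff hdK 5).mpr
      (hasIrreducibleModPGaloisRep_of_hasSurjectiveModNGaloisRep ((⟨0, -1, 1, -2, 0⟩ : WeierstrassCurve ℤ).map (Int.castRingHom ℚ)) 5 hsur)
  have h1 : 1 ≤ (((⟨0, -1, 1, -2, 0⟩ : WeierstrassCurve ℤ).map (Int.castRingHom ℚ)).quadraticTwist (NumberField.discr K : ℚ)).mordellWeilRank := by
    rw [hD, mordellWeilRank_quadraticTwist_eq_twistModel intModel (-7), AtThree.twistModel_neg7]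
    exact AtThree.one_le_rank_twist_neg7
  exact (exactRowZhang_5_neg7 h372 h84 K hK hD).trans
    ((and_iff_right Summit.BirchSwinnertonDyer.BirchSwinnertonDyer.Rank2Observatory.C709a1.mordellWeilRank_eq_two).trans
      (and_congr_right fun _ ↦ natCard_selmerGroup_le_iff_rank_eq_one_sha₁₅₃ _ 5 hirrT h1))

end C709a1

/-! ## `718b1` at `(p, d_K) = (5, -7)`: the twist model, its kernel point and torsion-freeness are the landed
`C718b1.AtThree.*` lemmas (file `…DepthTableJLSRowsTwoSha*`) -/

namespace C718b1

/-- **DEPTH-TABLE ROW `718b1`, `(p, d_K) = (5, −7)`, v12 — «ONE BIT ⟺ TWO `Ш`'s».** For `E = 718b1` and ANY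
imaginary quadratic `K` with `d_K = −7`: «some frame, some Kolyvagin prime `ℓ`, some datum of conductor
`ℓ` with `c_1(ℓ) ≠ 0`» `↔` «`Ш(E/ℚ)[5] = 0` ∧ `rank_ℤ E^{(−7)}(ℚ) = 1` ∧ `Ш(E^{(−7)}/ℚ)[5] = 0`». From the
row `C718b1.exactRowZhang_5_neg7` (rank discharged by the kernel 2-descent certificate) and `natCard_selmerGroup_le_iff_rank_eq_one_sha₁₅₃` at the twist, fed with
the kernel point `AtThree.one_le_rank_twist_neg7` (through `mordellWeilRank_quadraticTwist_eq_twistModel`) and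
the irreducibility of `E^{(−7)}[5]` (twist of the onto `ρ̄_{E,5}`). Every side condition is a kernel
theorem; CONDITIONAL on (γ) and W. Zhang's Lemma 8.4 (1) / Thm. 9.1 by name; per curve; BSD is not proved by it.
[cite: WZhang2014, Lemma 8.4 (1) (p. 236), Thm. 9.1 (p. 240)] [cite: GrossLMS1991, Prop. 3.7 (2)]
[cite: SilvermanAEC2009, Thm. X.4.2] [cite: CremonaAlgorithms1997, Table 1 (718b1)] -/
theorem exactRowZhang_5_neg7_twoSha
    (h372 : GrossLMS1991.prop37_2_frobeniusCongruence)
    (h84 : Literature.NumberTheory.EllipticCurves.WZhang2014_lemma84_exists_minimal_kolyvaginClass_one_selmerCard)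
    (K : Type) [Field K] [NumberField K] (hK : IsImaginaryQuadratic K)
    (hD : NumberField.discr K = -7) :
    haveI := isElliptic_c718b1;
    haveI := isGloballyMinimal_c718b1;
    haveI : NeZero (((⟨1, 0, 1, -5, 0⟩ : WeierstrassCurve ℤ).map (Int.castRingHom ℚ)).conductorNorm ℤ) := neZero_conductorNorm_of_isElliptic _;
    haveI := Fact.mk (by norm_num : Nat.Prime 5);
    (∃ (Dt : ModularParametrizationData ((⟨1, 0, 1, -5, 0⟩ : WeierstrassCurve ℤ).map (Int.castRingHom ℚ)) (((⟨1, 0, 1, -5, 0⟩ : WeierstrassCurve ℤ).map (Int.castRingHom ℚ)).conductorNorm ℤ)) (β : ℤ)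
      (ι : K →+* ℂ) (ℓ : ℕ) (d : KolyvaginHeegnerData Dt β ι ℓ),
      ℓ.Prime ∧ Zhang2014.IsKolyvaginPrime (((⟨1, 0, 1, -5, 0⟩ : WeierstrassCurve ℤ).map (Int.castRingHom ℚ)).conductorNorm ℤ) ((⟨1, 0, 1, -5, 0⟩ : WeierstrassCurve ℤ).map (Int.castRingHom ℚ)) K 5 ℓ ∧
        d.kolyvaginClass (p := 5) (by norm_num) 1 ≠ 0) ↔
    ((((⟨1, 0, 1, -5, 0⟩ : WeierstrassCurve ℤ).map (Int.castRingHom ℚ)).sha ⊓ AddSubgroup.torsionBy ((⟨1, 0, 1, -5, 0⟩ : WeierstrassCurve ℤ).map (Int.castRingHom ℚ)).galH1 ((5 : ℕ) : ℤ) : AddSubgroup _) = ⊥ ∧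
      (((⟨1, 0, 1, -5, 0⟩ : WeierstrassCurve ℤ).map (Int.castRingHom ℚ)).quadraticTwist (NumberField.discr K : ℚ)).mordellWeilRank = 1 ∧
      ((((⟨1, 0, 1, -5, 0⟩ : WeierstrassCurve ℤ).map (Int.castRingHom ℚ)).quadraticTwist (NumberField.discr K : ℚ)).sha ⊓
          AddSubgroup.torsionBy (((⟨1, 0, 1, -5, 0⟩ : WeierstrassCurve ℤ).map (Int.castRingHom ℚ)).quadraticTwist (NumberField.discr K : ℚ)).galH1 ((5 : ℕ) : ℤ) :
          AddSubgroup (((⟨1, 0, 1, -5, 0⟩ : WeierstrassCurve ℤ).map (Int.castRingHom ℚ)).quadraticTwist (NumberField.discr K : ℚ)).galH1) = ⊥) := by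
  haveI := isElliptic_c718b1
  haveI := isGloballyMinimal_c718b1
  haveI : NeZero (((⟨1, 0, 1, -5, 0⟩ : WeierstrassCurve ℤ).map (Int.castRingHom ℚ)).conductorNorm ℤ) := neZero_conductorNorm_of_isElliptic _
  haveI := Fact.mk (by norm_num : Nat.Prime 5)
  have hdK : (NumberField.discr K : ℚ) ≠ 0 := by exact_mod_cast NumberField.discr_ne_zero K
  haveI := ((⟨1, 0, 1, -5, 0⟩ : WeierstrassCurve ℤ).map (Int.castRingHom ℚ)).isElliptic_quadraticTwist hdK
  have hsur : ((⟨1, 0, 1, -5, 0⟩ : WeierstrassCurve ℤ).map (Int.castRingHom ℚ)).HasSurjectiveModNGaloisRep (5 ^ 1 : ℕ) := hasSurjectiveModNGaloisRep_pow_5 1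
  rw [pow_one] at hsur
  have hirrT : (((⟨1, 0, 1, -5, 0⟩ : WeierstrassCurve ℤ).map (Int.castRingHom ℚ)).quadraticTwist (NumberField.discr K : ℚ)).HasIrreducibleModPGaloisRep 5 :=
    (((⟨1, 0, 1, -5, 0⟩ : WeierstrassCurve ℤ).map (Int.castRingHom ℚ)).hasIrreducibleModPGaloisRep_quadraticTwist_iff hdK 5).mpr
      (hasIrreducibleModPGaloisRep_of_hasSurjectiveModNGaloisRep ((⟨1, 0, 1, -5, 0⟩ : WeierstrassCurve ℤ).map (Int.castRingHom ℚ)) 5 hsur)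
  have h1 : 1 ≤ (((⟨1, 0, 1, -5, 0⟩ : WeierstrassCurve ℤ).map (Int.castRingHom ℚ)).quadraticTwist (NumberField.discr K : ℚ)).mordellWeilRank := by
    rw [hD, mordellWeilRank_quadraticTwist_eq_twistModel intModel (-7), AtThree.twistModel_neg7]
    exact AtThree.one_le_rank_twist_neg7
  exact (exactRowZhang_5_neg7 h372 h84 K hK hD).trans
    ((and_iff_right Summit.BirchSwinnertonDyer.BirchSwinnertonDyer.Rank2Observatory.C718b1.mordellWeilRank_eq_two).trans
      (and_congr_right fun _ ↦ natCard_selmerGroup_le_iff_rank_eq_one_sha₁₅₃ _ 5 hirrT h1))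

end C718b1

end Summit.BirchSwinnertonDyer.BirchSwinnertonDyer.Theorems.KolyvaginDepthDoor

end
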